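import Mathlib
import Summits.Ventures.PercRepro2.Defs
import Summits.Ventures.PercRepro2.Independence
import Summits.Ventures.PercRepro2.Harris
import Summits.Ventures.PercRepro2.CoinDefs
import Summits.Ventures.PercRepro2.CoinArcsOff
import Summits.Ventures.PercRepro2.CoinPendantDefs
import Summits.Ventures.PercRepro2.CoinPendant
import Summits.Ventures.PercRepro2.CoinInduced
import Summits.Ventures.PercRepro2.CoinVdBK
import Summits.Ventures.PercRepro2.CoinBHK
import Summits.Ventures.PercRepro2.CoinReverse
import Summits.Ventures.PercRepro2.CoinTwoPendantDefs
import Summits.Ventures.PercRepro2.CoinTwoPendantMass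
import Summits.Ventures.PercRepro2.CoinTraceLevels
import Summits.Ventures.PercRepro2.CoinTraceTower

/-!
# (CU-PA): positive association of the trace law on a CYLINDER up-set, by pinning (blind cell
PercRepro2, night-2 g3; proofs/NIGHT2-DARC.md §17)

Let `v ∈ P` be a LEAF of the pendant structure: its membership in `K⁻` is decided by one pendant
coin `c` (`bwdEvent arcs v {t} = openEdge c`).  Pinning `c` open (`p[c ↦ 1]`, still admissible)
leaves a coin system in which `v ∈ K⁻` surely; `trace_bhk` applies to it, and the pinning
identities (`prob_eq_pin`, `prob_update_one_inter_openEdge`, `expect_update_one`) translate its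
trace law back: `μ_Z = p_c · μ'_Z` for `Z ∋ v`, `μ'_Z = 0` for `Z ∌ v`, the reduced events being
unchanged (they do not see `c`).  Result (`trace_cu_pa`): for monotone nonnegative `g₁, g₂`,
`(Σ_{Z ∋ v} g₁ μ)(Σ_{Z ∋ v} g₂ μ) ≤ (Σ_{Z ∋ v} g₁g₂ μ)(Σ_{Z ∋ v} μ)` — the (CU-PA) input of
NIGHT2-DARC.md §15.8, the second sign block of the single-vertex up-sets.
-/

namespace Summit.Ventures.PercRepro2.Coin

section Pin

variable {E : Type*} [Fintype E] [DecidableEq E] {R : Type*} [CommRing R]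

/-- An event determined away from `e` has the same probability after pinning `e` open. -/
lemma prob_update_one_of_dependsOn (p : E → R) (e : E) {D : Set (Config E)}
    (hD : DependsOn (· ∈ D) ({e} : Set E)ᶜ) :
    prob (Function.update p e 1) D = prob p D := by
  rw [prob_eq_expect_indicator, prob_eq_expect_indicator, expect_update_one]
  unfold expect
  refine Finset.sum_congr rfl fun ω _ => ?_
  have hmem : Function.update ω e true ∈ D ↔ ω ∈ D := by
    refine dependsOn_mem_iff hD fun e' he' => ?_
    rw [Set.mem_compl_iff, Set.mem_singleton_iff] at he'
    exact Function.update_of_ne he' _ _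
  show weight p ω * D.indicator 1 (Function.update ω e true) = weight p ω * D.indicator 1 ω
  by_cases h : ω ∈ D
  · rw [Set.indicator_of_mem h, Set.indicator_of_mem (hmem.mpr h), Pi.one_apply, Pi.one_apply]
  · rw [Set.indicator_of_notMem h, Set.indicator_of_notMem (fun h' => h (hmem.mp h'))]

/-- An event inside `{e open}` has probability `p e` times its probability with `e` pinned open. -/
lemma prob_eq_mul_prob_update_one_of_subset (p : E → R) (e : E) {D : Set (Config E)}
    (hD : D ⊆ openEdge e) : prob p D = p e * prob (Function.update p e 1) D := by
  rw [prob_eq_pin p D e]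
  have h0 : prob (Function.update p e 0) D = 0 := by
    rw [← Set.inter_eq_left.mpr hD]
    exact prob_update_zero_inter_openEdge p D e
  rw [h0, mul_zero, add_zero]

/-- An event inside `{e closed}` is null once `e` is pinned open. -/
lemma prob_update_one_eq_zero_of_subset (p : E → R) (e : E) {D : Set (Config E)}
    (hD : D ⊆ closedEdge e) : prob (Function.update p e 1) D = 0 := by
  rw [← Set.inter_eq_left.mpr hD]
  exact prob_update_one_inter_closedEdge p D e

end Pin

section CUPA

open Classical

variable {V : Type*} {E : Type*} [Fintype V] [DecidableEq V] [Fintype E] [DecidableEq E]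
  {R : Type*} [Field R] [LinearOrder R] [IsStrictOrderedRing R]

omit [Fintype V] [Fintype E] [DecidableEq E] in
/-- The reduced avoidance events do not see a pendant coin. -/
lemma dependsOn_avoid_reduced_compl_single {arcs : E → Finset (V × V)} {P T : Finset V}
    (hT : TailCoinsIn arcs P T) {c : E} (hc : c ∈ tailCoins arcs P) (s : V) (X : Finset V) :
    DependsOn (· ∈ avoidEvent (arcsOff arcs (P ∪ T)) s X) ({c} : Set E)ᶜ := by
  intro ω ω' h
  have hcongr : ∀ e, arcsOff arcs (P ∪ T) e ≠ ∅ → ω e = ω' e := by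
    intro e he
    by_cases hec : e = c
    · subst hec; exact absurd (arcsOff_eq_empty_of_tailCoins hT hc) he
    · exact h e (by rw [Set.mem_compl_iff, Set.mem_singleton_iff]; exact hec)
  have hreach : ∀ x y, Reach (arcsOff arcs (P ∪ T)) ω x y ↔ Reach (arcsOff arcs (P ∪ T)) ω' x y :=
    fun x y => reach_arcsOff_congr hcongr
  simp only [avoidEvent, Set.mem_setOf_eq, hreach]

omit [Fintype V] [DecidableEq V] [Fintype E] [DecidableEq E] in
/-- A level containing the leaf `v` lies in `{c open}`. -/
lemma traceLevel_subset_openEdge {arcs : E → Finset (V × V)} {P : Finset V} {t v : V}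
    (hv : v ∈ P) {c : E} (hleaf : bwdEvent arcs v {t} = openEdge c) {Z : Finset V} (hvZ : v ∈ Z) :
    traceLevel arcs {t} P Z ⊆ openEdge c := by
  intro ω hω
  rw [← hleaf]
  exact (hω v hv).mp hvZ

omit [Fintype V] [DecidableEq V] [Fintype E] [DecidableEq E] in
/-- A level avoiding the leaf `v` lies in `{c closed}`. -/
lemma traceLevel_subset_closedEdge {arcs : E → Finset (V × V)} {P : Finset V} {t v : V}
    (hv : v ∈ P) {c : E} (hleaf : bwdEvent arcs v {t} = openEdge c) {Z : Finset V}
    (hvZ : v ∉ Z) : traceLevel arcs {t} P Z ⊆ closedEdge c := by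
  intro ω hω
  rw [closedEdge_eq_compl, Set.mem_compl_iff, ← hleaf]
  exact fun h => hvZ ((hω v hv).mpr h)

/-- **(CU-PA) of the trace law in mass form**: for a leaf `v ∈ P` decided by the pendant coin `c`
and monotone nonnegative `g₁, g₂`, with `𝒱_v = {Z ⊆ P : v ∈ Z}` and `μ_Z = ℓ_Z · P_Z`,
`(Σ_{𝒱_v} g₁ μ)(Σ_{𝒱_v} g₂ μ) ≤ (Σ_{𝒱_v} g₁g₂ μ)(Σ_{𝒱_v} μ)`. -/
theorem trace_cu_pa (p : E → R) (hp : IsProbVec p) {arcs : E → Finset (V × V)}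
    (hS : SameEnds arcs) {P : Finset V} {t : V} (hclosed : ClosedOut arcs P {t})
    (hT : TailCoinsIn arcs P {t}) {v : V} (hv : v ∈ P) {c : E} (hc : c ∈ tailCoins arcs P)
    (hleaf : bwdEvent arcs v {t} = openEdge c) (s : V) {g₁ g₂ : Set V → R}
    (h₁ : Monotone g₁) (h₂ : Monotone g₂) (h₁0 : ∀ S, 0 ≤ g₁ S) (h₂0 : ∀ S, 0 ≤ g₂ S) :
    (∑ Z ∈ P.powerset.filter (fun Z => v ∈ Z),
        g₁ ↑Z * (prob p (traceLevel arcs {t} P Z) *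
          prob p (avoidEvent (arcsOff arcs (P ∪ {t})) s (Z ∪ {t}))))
      * (∑ Z ∈ P.powerset.filter (fun Z => v ∈ Z),
        g₂ ↑Z * (prob p (traceLevel arcs {t} P Z) *
          prob p (avoidEvent (arcsOff arcs (P ∪ {t})) s (Z ∪ {t})))) ≤
    (∑ Z ∈ P.powerset.filter (fun Z => v ∈ Z),
        g₁ ↑Z * g₂ ↑Z * (prob p (traceLevel arcs {t} P Z) *
          prob p (avoidEvent (arcsOff arcs (P ∪ {t})) s (Z ∪ {t}))))
      * (∑ Z ∈ P.powerset.filter (fun Z => v ∈ Z),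
        prob p (traceLevel arcs {t} P Z) *
          prob p (avoidEvent (arcsOff arcs (P ∪ {t})) s (Z ∪ {t}))) := by
  set p' := Function.update p c 1 with hp'def
  have hp' : IsProbVec p' := hp.update c zero_le_one le_rfl
  have hpc : 0 ≤ p c := hp.nonneg c
  -- the pinned trace law
  have hR : ∀ Z : Finset V, prob p' (avoidEvent (arcsOff arcs (P ∪ {t})) s (Z ∪ {t})) =
      prob p (avoidEvent (arcsOff arcs (P ∪ {t})) s (Z ∪ {t})) := fun Z =>
    prob_update_one_of_dependsOn p c (dependsOn_avoid_reduced_compl_single hT hc s _)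
  have hμ : ∀ Z : Finset V, v ∈ Z →
      prob p (traceLevel arcs {t} P Z) * prob p (avoidEvent (arcsOff arcs (P ∪ {t})) s (Z ∪ {t}))
        = p c * (prob p' (traceLevel arcs {t} P Z) *
          prob p' (avoidEvent (arcsOff arcs (P ∪ {t})) s (Z ∪ {t}))) := by
    intro Z hvZ
    rw [hR Z, prob_eq_mul_prob_update_one_of_subset p c (traceLevel_subset_openEdge hv hleaf hvZ)]
    ring
  have hμ0 : ∀ Z : Finset V, v ∉ Z → prob p' (traceLevel arcs {t} P Z) = 0 := fun Z hvZ =>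
    prob_update_one_eq_zero_of_subset p c (traceLevel_subset_closedEdge hv hleaf hvZ)
  -- sums over the pinned law restrict to `𝒱_v`
  have hsum : ∀ F : Finset V → R,
      ∑ Z ∈ P.powerset.filter (fun Z => Disjoint Z (∅ : Finset V)),
          F Z * (prob p' (traceLevel arcs {t} P Z) *
            prob p' (avoidEvent (arcsOff arcs (P ∪ {t})) s (Z ∪ {t}))) =
        ∑ Z ∈ P.powerset.filter (fun Z => v ∈ Z),
          F Z * (prob p' (traceLevel arcs {t} P Z) *
            prob p' (avoidEvent (arcsOff arcs (P ∪ {t})) s (Z ∪ {t}))) := by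
    intro F
    rw [Finset.sum_filter, Finset.sum_filter]
    refine Finset.sum_congr rfl fun Z _ => ?_
    by_cases hvZ : v ∈ Z
    · simp only [Finset.disjoint_empty_right, if_true, hvZ]
    · simp only [Finset.disjoint_empty_right, if_true, hvZ, if_false, hμ0 Z hvZ, zero_mul,
        mul_zero]
  -- the original sums are `p c` times the pinned ones
  have hconv : ∀ F : Finset V → R,
      ∑ Z ∈ P.powerset.filter (fun Z => v ∈ Z),
          F Z * (prob p (traceLevel arcs {t} P Z) *
            prob p (avoidEvent (arcsOff arcs (P ∪ {t})) s (Z ∪ {t}))) =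
        p c * ∑ Z ∈ P.powerset.filter (fun Z => v ∈ Z),
          F Z * (prob p' (traceLevel arcs {t} P Z) *
            prob p' (avoidEvent (arcsOff arcs (P ∪ {t})) s (Z ∪ {t}))) := by
    intro F
    rw [Finset.mul_sum]
    refine Finset.sum_congr rfl fun Z hZ => ?_
    rw [hμ Z (Finset.mem_filter.mp hZ).2]
    ring
  have h := trace_pa p' hp' hS hclosed hT (Finset.empty_subset P) s h₁ h₂ h₁0 h₂0
  have h1 := hsum (fun Z => g₁ ↑Z)
  have h2 := hsum (fun Z => g₂ ↑Z)
  have h12 := hsum (fun Z => g₁ ↑Z * g₂ ↑Z)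
  have h0 := hsum (fun _ => 1)
  simp only [one_mul] at h0
  rw [h1, h2, h12, h0] at h
  have c1 := hconv (fun Z => g₁ ↑Z)
  have c2 := hconv (fun Z => g₂ ↑Z)
  have c12 := hconv (fun Z => g₁ ↑Z * g₂ ↑Z)
  have c0 := hconv (fun _ => 1)
  simp only [one_mul] at c0
  rw [c1, c2, c12, c0]
  have hsq : 0 ≤ p c * p c := mul_nonneg hpc hpc
  have := mul_le_mul_of_nonneg_left h hsq
  calc p c * _ * (p c * _) = p c * p c * (_ * _) := by ring
    _ ≤ p c * p c * (_ * _) := this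
    _ = _ := by ring

end CUPA

end Summit.Ventures.PercRepro2.Coin
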